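import Mathlib
import Summits.SmoothPoincare4.SmoothPoincare4.Theorems.SullivanDualTameOrBrodyR4OfNoCusp
import Literature.Geometry.Symplectic.JHolomorphicRepresentationFormula

/-!
# Crux `TameOrBrodyR4` (stmt-SmoothPoincare4-7826) — the route declaration, proved (line `Sketch`)

`TameOrBrodyR4_proof : Theses.SullivanDual.TameOrBrodyR4`: every `C^∞` almost complex structure
`J` on `ℝ⁴` which is the standard one outside a ball is EITHER tamed by a closed `2`-form equal to
`ω₀` outside a ball OR carries a non-constant bounded entire `J`-holomorphic curve.

Composition of the line's kernel reduction `helper_tameOrBrodyR4OfNoCusp`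
(`Theorems/SullivanDualTameOrBrodyR4OfNoCusp.lean`: Gromov's anchored pencils — the classical
continuity method, the planar replacements of the intersection theory, CORE-A = the
implicit-function-theorem package with local uniqueness `stub_localFamilyUnique`, CORE-B =
immersed limits modulo McDuff's no-cusp theorem `helper_immersedLimitsOfNoCusp`; leads 0, c1–c7,
≈ 125 files `Theorems/SullivanDualTameOrBrodyR4*.lean`) with the Literature theorem
`Literature.Geometry.Symplectic.jHolomorphic_immersed_of_limitEmbedded_punctured_holds`
(`Literature/Geometry/Symplectic/JHolomorphicRepresentationFormula.lean`: McDuff 1991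
Thm 1.4 / Cor. 4.4 via Wendl 2020 Thm B.23 with the rotation clause (B.12), proved there from
the adapted normal form, the rotated branch of (B.20), the Cauchy–Riemann inequality of Prop. B.28
in the original variable and the punctured similarity principle).
-/

-- the registered namespace `Summit.SmoothPoincare4.SmoothPoincare4.…` repeats a component
set_option linter.dupNamespace false

noncomputable section

namespace Summit.SmoothPoincare4.SmoothPoincare4.Cruxes.TameOrBrodyR4.Sketch

/-- **Crux `TameOrBrodyR4` (stmt-SmoothPoincare4-7826): tame or Brody on `ℝ⁴`.** For every
`C^∞` almost complex structure `J` on `ℝ⁴ = EuclideanSpace ℝ (Fin 4)` with `J² = -1` and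
`⟪J x a, b⟫ = ω₀(a, b)` for `‖x‖ ≥ R` (`0 < R`), EITHER there are `R'` and a `C^∞` closed
`2`-form `sf` (`extDeriv sf = 0`) equal to `ω₀` for `‖x‖ ≥ R'` with `sf x (v, J x v) > 0` for all
`v ≠ 0`, OR there is a `C^∞` map `u : ℂ → ℝ⁴`, non-constant and bounded, with
`du z (iζ) = J (u z) (du z ζ)`. -/
theorem TameOrBrodyR4_proof :
    Summit.SmoothPoincare4.SmoothPoincare4.Theses.SullivanDual.TameOrBrodyR4 :=
  helper_tameOrBrodyR4OfNoCusp
    Literature.Geometry.Symplectic.jHolomorphic_immersed_of_limitEmbedded_punctured_holds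

end Summit.SmoothPoincare4.SmoothPoincare4.Cruxes.TameOrBrodyR4.Sketch
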